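import Summits.BirchSwinnertonDyer.BirchSwinnertonDyer.Theorems.SignedLowerHalvesSmallImageLowerHalfBothSignsRttEngineUnitCurve
import Summits.BirchSwinnertonDyer.BirchSwinnertonDyer.Theorems.SignedLowerHalvesSmallImageLowerHalfBothSignsRttOneSidedCruxTieredSupply
import Summits.BirchSwinnertonDyer.BirchSwinnertonDyer.Theorems.SignedLowerHalvesSmallImageLowerHalfBothSignsRttOneSidedCore
import Summits.BirchSwinnertonDyer.BirchSwinnertonDyer.Theorems.SignedLowerHalvesSmallImageLowerHalfBothSignsRttKanThetaLayerLambda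
import HarnessLib

/-!
# Route `SignedLowerHalves`, crux L `SmallImageLowerHalfBothSigns` (item stmt-BirchSwinnertonDyer-23599), line `rtt_w3` v4:
# TIER «T1u» — crux L's body AT EVERY PAIR WITH A UNIT CURVE PARTNER, modulo print (+ the one-sign floor off `p = 3`)

Width seat `bsd-line-slh-p3-w3` g13 under LEAD `cruxlead-stmt-BirchSwinnertonDyer-23599` g2 (cell `bsd-ssimc`); helper
`--supports stmt-BirchSwinnertonDyer-23599`; THEOREMS ONLY — no definition, no named fact, no `sorry`. PER PAIR (the class-wide crux
stays open); BSD is proved for no curve by this: every theorem below is CONDITIONAL on the displayed PUBLISHED named facts, and a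
pair needs its certificate (`A`, a `Γ_ℚ`-equivariant `W[p] ≃ A[p]`, a unit `L`-value of `A`).

THE TIER. A small-image supersingular X7 pair `(W, p)` (`p` odd, `ClassX7 W p`, `a_p = 0`, `¬ Surj W p`) is «T1u» if SOME globally
minimal elliptic curve `A/ℚ` — CM or not, any conductor — is good at `p` with `a_p(A) = 0`, has `W[p] ≃ A[p]` `Γ_ℚ`-equivariantly, and
has a non-zero `p`-adic UNIT `L`-value `L(A,1)/Ω_A = t` (`ord_p t = 0`; in particular `A` has analytic rank `0`). Then the rtt_w3
transport runs with the partner `g = f_A` and NO main-conjecture input at the partner (`…RttEngineUnitCurve`: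
`λ(L^ε_p(A)) = 0 ≤ λ(X^ε_A)`), so crux L's body at the pair follows from ELEVEN published named facts — Kobayashi 2003 (`hJ h12 h41`),
the period units (`h5 h3`), Hida/Carayol/Saito (`hD hC hS`, level clause), modularity (`hmod`), B. D. Kim 2009 Cor 2.13 (`hKim`),
Vatsal 1999 (`hV`) — and NOT Pollack–Rubin. The LEAD's T2 (57 pairs without a CM-curve partner; seam (C-S2) unprinted) loses every
pair with such an `A`: the k3-c4 census of crux 4 already lists 7 (database partners); rank-`0` members of the Hesse pencil
`X_W(3) ≅ ℙ¹` (Fisher 2012) / of `X_W(5)` with a unit `L`-value are further ones (a kit search per pair).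

* §1 `thetaLayerLambda_of_partner` — Kan₂ (landed p747435) re-wrapped WITHOUT its idle binders `¬ W.HasCM`, `¬ Surj W p`,
  `IsCMForm g` (underscored-unused in the landed proof): the layer-`λ` equality for ANY level-matched congruent newform partner.
* §2 `curvePartner_supply` — every partner clause for the newform `f_A` of ANY congruent curve `A` good at `p` with `a_p(A) = 0`
  (`cmCurvePartner_supply`, p747597 §2, minus CM): modularity, `p ∤ N_A`, the level clause (`levelMatch`, p742955), newform,
  `a_p(f_A) = 0`, a cohomological plus period, the trace congruence off `p·N_A·N_W` (Kraus–Oesterlé), a Pollack pair.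
* §3 `lamTransport_le_of_unitCurvePartner` — the one-sided transport at a T1u pair, every sign.
* §4 ★ `forall_kobayashiLowerDivisibility_three_of_unitCurvePartner` (`p = 3`, floor-free: THEOREM B) and
  ★ `forall_kobayashiLowerDivisibility_of_unitCurvePartner_of_oneSignFloor` (`p ≥ 5`, from the one-sign floor AT THE PAIR).

References: [Kobayashi2003] Conjecture (p. 2), (3.6), Thm. 1.2, 4.1, 7.4; [BDKim2009] Cor. 2.13; [Vatsal1999] (1.6), (1.13);
[KrausOesterle1992] §3 Prop. 3; [PollackWeston2011MT] §3.1, Thm. 4.1; [GreenbergVatsal2000] Prop. (2.4), §3 Rem. 3.4; [Pollack2003]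
Conj. 6.3, Prop. 6.18; [Fisher2012Hessian] §13.
-/

set_option autoImplicit false
-- D-0017: single-problem summit, the namespace repeats the problem name by design.
set_option linter.dupNamespace false
noncomputable section

open scoped Classical MatrixGroups ModularForm BigOperators

open CongruenceSubgroup WeierstrassCurve Field Polynomial NumberField IsDedekindDomain
  Literature.NumberTheory.EllipticCurves Literature.NumberTheory.EllipticCurves.ModularForms
  Literature.NumberTheory.EllipticCurves.Rank1Residual
  Literature.NumberTheory.EllipticCurves.Kobayashi2003
  Literature.NumberTheory.EllipticCurves.GreenbergVatsal2000 ZpExtension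
  Literature.NumberTheory.IwasawaTheory Rat.HeightOneSpectrum
  Summit.BirchSwinnertonDyer.Rank1Residual.Supersingular
  Summit.BirchSwinnertonDyer.Rank1Residual.X1.MuLambda
  Summit.BirchSwinnertonDyer.Rank1Residual.X2.EulerFactorInvariants
  Summit.BirchSwinnertonDyer.BirchSwinnertonDyer.Theorems.SmallImageLambdaLowerThreeNsThetaTransport

namespace Summit.BirchSwinnertonDyer.BirchSwinnertonDyer.Theorems.SmallImageRttOneSided

/-! ## §1 Kan₂ for ANY level-matched congruent partner (the landed proof, idle binders dropped) -/

section Kan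

open Summit.BirchSwinnertonDyer.BirchSwinnertonDyer.Theorems.SmallImageRttKan

/-- **Kan₂ without its idle binders.** The landed stub `SmallImageRttKan.stub_thetaLayerLambda_ns` (p747435) carries the class binders
`¬ W.HasCM`, `¬ Surj W p` and the partner clause `IsCMForm g` UNUSED (underscored in its proof): Vatsal's unit-ratio symbol congruence
(brick K9b `exists_unit_symbol_congruence`), the `W`-side unit sup norm (K5) and the layer-sum identities (K1′) need only `p` odd,
`ClassX7 W p`, `a_p(W) = 0`, a Γ₀(M) newform `g` with `p ∤ M`, the level clause, `a_p(g) = 0`, a plus period and the trace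
congruence off `p·M·N_W`. Same statement otherwise, same proof; first hypothesis Vatsal 1999 BY NAME.
[cite: Vatsal1999, Thm. (1.6), (1.13), (1.10)–(1.11)] [cite: GreenbergVatsal2000, §1 (8)–(9), §3 (18)–(19)] [cite: Pollack2003, Prop. 6.18]
[cite: PollackWeston2011MT, §2.2, §3.1 and Thm. 4.1] -/
theorem thetaLayerLambda_of_partner (hV : vatsal1999_plusSymbol_congruence)
    (W : WeierstrassCurve ℚ) [W.IsElliptic] [W.IsGloballyMinimal] (p : ℕ) [Fact p.Prime]
    (hp2 : p ≠ 2) (hX7 : ClassX7 W p) (hap : W.frobeniusTrace p = 0) (ε : ℤˣ)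
    (M : ℕ) [NeZero M] (g : CuspForm (Gamma0 M) 2) (ι : coeffField g →+* PadicAlgCl p) (Ω : ℂ)
    (hpM : ¬ p ∣ M) (hlev : ∀ ℓ : ℕ, ℓ.Prime → ℓ ≠ p → max 2 (padicValNat ℓ M) = max 2 (padicValNat ℓ (W.conductorNorm ℤ)))
    (hg : IsNewform0 g) (hgp : cuspCoeff g p = 0) (hΩ : IsPlusPeriod g Ω)
    (hcong : ∀ ℓ : ℕ, ℓ.Prime → ¬ ℓ ∣ p * M * W.conductorNorm ℤ →
      ‖embCoeff g ι ℓ - (W.frobeniusTrace ℓ : PadicAlgCl p)‖ < 1) :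
    ∀ [NeZero (W.conductorNorm ℤ)] (f : CuspForm (Gamma0 (W.conductorNorm ℤ)) 2), IsNewformOf W f →
    ∀ (Lplus Lminus : IwasawaAlgebra p), IsPollackPair f p Lplus Lminus →
      HasUnitContent (kobayashiL ε Lplus Lminus) →
    ∀ (S₀ : Finset (HeightOneSpectrum (𝓞 ℚ))), (∀ v ∈ S₀, ((p : ℕ) : 𝓞 ℚ) ∉ v.asIdeal) →
      (∀ v : HeightOneSpectrum (𝓞 ℚ), ¬ W.HasGoodReductionAt v → v ∈ S₀) →
      (∀ v : HeightOneSpectrum (𝓞 ℚ), natGenerator v ∣ M → v ∈ S₀) →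
    ∃ n₀ : ℕ, ∀ n ≥ n₀, (Even n ↔ ε = 1) →
      layerLambda (((mazurTateElement f p n).map (algebraMap ℚ (PadicAlgCl p)) *
          ∏ v ∈ S₀, ((W.localPolynomialAt v).map (Int.castRingHom (PadicAlgCl p))).comp
            (C ((natGenerator v : PadicAlgCl p)⁻¹) *
              (X + 1) ^ (PadicInt.toZModPow n (-(frobeniusExponent p (natGenerator v : ℤ_[p])))).val)) %ₘ
          ((X + 1) ^ p ^ n - 1)) =
      layerLambda (((mazurTateElementK g Ω p n).map ι *
          ∏ v ∈ S₀, (1 - C (embCoeff g ι (natGenerator v)) * X +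
              (if natGenerator v ∣ M then 0 else C (natGenerator v : PadicAlgCl p)) * X ^ 2).comp
            (C ((natGenerator v : PadicAlgCl p)⁻¹) *
              (X + 1) ^ (PadicInt.toZModPow n (-(frobeniusExponent p (natGenerator v : ℤ_[p])))).val)) %ₘ
          ((X + 1) ^ p ^ n - 1)) := by
  intro _ f hf Lplus Lminus hPP hunit S₀ hS₀p hS₀bad hS₀M
  classical
  have hp : p.Prime := Fact.out
  have hS : ∀ v ∈ S₀, natGenerator v ≠ p := fun v hv ↦ natGenerator_ne_of_natCast_not_mem v (hS₀p v hv)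
  -- Vatsal's unit-ratio symbol congruence for the depleted pair (brick K9b)
  obtain ⟨uf, ug, hug, huf, hA, hAB⟩ :=
    exists_unit_symbol_congruence hV W hp2 hX7 hap ι hpM hlev hg hgp hΩ hcong hf S₀ hS hS₀bad hS₀M
  -- `‖R_W‖_sup = 1` eventually at the parity of `ε` (brick K5)
  obtain ⟨n₀, hn₀⟩ := eventually_supNorm_depleted_eq_one_of_isPollackPair W hp2 f hPP ε hunit S₀ hS
  refine ⟨n₀, fun n hn hpar ↦ ?_⟩
  have hsup := (hn₀ n hn hpar).1
  haveI : NeZero (p ^ n) := ⟨pow_ne_zero _ hp.ne_zero⟩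
  haveI := neZero_torsionOrder p
  -- both sides are layer sums of the depleted symbols (brick K1′)
  rw [depletedCurveLayer_eq_layerSum_depletedSymbol' f W n S₀ hS] at hsup ⊢
  rw [depletedPartnerLayer_eq_layerSum_depletedSymbol' g Ω ι n M S₀ hS]
  exact layerLambda_layerSum_eq_of_unit_congruence _ _ hug huf
    (fun t ↦ norm_mul_finsum_le_one _ _ fun η ↦ hA _)
    (fun t ↦ norm_mul_finsum_sub_lt_one _ _ _ _ fun η ↦ hAB _) hsup

end Kan

/-! ## §2 Every partner clause for the newform of ANY congruent curve good at `p` with `a_p = 0` -/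

section Supply

/-- **SUPPLY for a curve partner (no CM).** Let `(W, p)` be odd-prime good, and `A/ℚ` a globally minimal curve, good at `p` with
`a_p(A) = 0`, with a `Γ_ℚ`-equivariant `W[p] ≃ A[p]`. GRANTED BY NAME modularity (`hmod`) and Hida / Carayol / Saito (`hD hC hS`,
for the level clause): with `M = N_A` and `g = f_A` there are `ι : K_g → ℚ̄_p`, a COHOMOLOGICAL plus period `Ω` and a Pollack pair of
`g`, and `p ∤ N_A`, `max 2 (v_ℓ N_A) = max 2 (v_ℓ N_W)` (`ℓ ≠ p`), `g` is a newform, `a_p(g) = 0`, and `‖ι a_ℓ(g) − a_ℓ(W)‖ < 1` for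
every prime `ℓ ∤ p·N_A·N_W` (Kraus–Oesterlé). This is `cmCurvePartner_supply` (p747597 §2) with the CM clause and `ϖ_A` removed;
no new mathematics. [cite: KrausOesterle1992, §3 Prop. 3 (i) ⇒ (iii)] [cite: PollackWeston2011MT, Def. 2.1]
[cite: Pollack2003, Thm. 5.6, Prop. 6.18] [cite: BreuilConradDiamondTaylor2001, Thm. A] -/
theorem curvePartner_supply (hD : Hida2000_thm326_exists_galoisRep) (hC : Carayol1986_artinConductorExponent)
    (hS : ∀ (V : WeierstrassCurve ℚ) (ℓ : ℕ) [Fact ℓ.Prime],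
      V.swanConductorAt_rationalTate_eq_wildConductorExponent_of_ringChar_eq_two ℓ)
    (hmod : exists_isNewformOf)
    (W A : WeierstrassCurve ℚ) [W.IsElliptic] [W.IsGloballyMinimal] [A.IsElliptic] [A.IsGloballyMinimal]
    (p : ℕ) [Fact p.Prime] (hp : p ≠ 2)
    (hgoodA : A.HasGoodReductionAtPrime p) (hapA : A.frobeniusTrace p = 0)
    (he : ∃ e : geomTorsion W (p : ℤ) ≃+ geomTorsion A (p : ℤ),
      ∀ (σ : absoluteGaloisGroup ℚ) (P : geomTorsion W (p : ℤ)), e (σ • P) = σ • e P) :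
    ∃ (_ : NeZero (A.conductorNorm ℤ)) (g : CuspForm (Gamma0 (A.conductorNorm ℤ)) 2)
      (ι : coeffField g →+* PadicAlgCl p) (Ω : ℂ),
      IsNewformOf A g ∧ ¬ p ∣ A.conductorNorm ℤ ∧
        (∀ ℓ : ℕ, ℓ.Prime → ℓ ≠ p → max 2 (padicValNat ℓ (A.conductorNorm ℤ)) = max 2 (padicValNat ℓ (W.conductorNorm ℤ))) ∧
        IsNewform0 g ∧ cuspCoeff g p = 0 ∧ IsCohomologicalPlusPeriod g ι Ω ∧
        (∀ ℓ : ℕ, ℓ.Prime → ¬ ℓ ∣ p * A.conductorNorm ℤ * W.conductorNorm ℤ →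
          ‖embCoeff g ι ℓ - (W.frobeniusTrace ℓ : PadicAlgCl p)‖ < 1) ∧
        (∃ Lp Lm : IwasawaAlgebra p, IsPollackPair g p Lp Lm) := by
  haveI hNA : NeZero (A.conductorNorm ℤ) := ⟨(A.conductorNorm_pos_holds).ne'⟩
  -- the newform of `A`
  obtain ⟨g, hg⟩ := hmod A
  have hQ : coeffField g = ⊥ := hg.coeffField_eq_bot
  -- `ι : K_g = ℚ → ℚ̄_p`
  let ι : coeffField g →+* PadicAlgCl p :=
    (algebraMap ℚ (PadicAlgCl p)).comp
      ((IntermediateField.botEquiv ℚ ℂ).toAlgHom.toRingHom.comp (IntermediateField.equivOfEq hQ).toAlgHom.toRingHom)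
  -- a cohomological plus period along `ι`
  obtain ⟨Ω, hΩ⟩ :=
    Summit.BirchSwinnertonDyer.BirchSwinnertonDyer.Theorems.CohomologicalPeriod.exists_isCohomologicalPlusPeriod hg.1 ι
  -- `p ∤ N_A`
  have hpN : ¬ p ∣ A.conductorNorm ℤ := not_dvd_level_of_isNewformOf hg hgoodA
  -- the trace congruence off `p·N_A·N_W` (Kraus–Oesterlé)
  obtain ⟨e, hecomm⟩ := he
  have hcong : ∀ ℓ : ℕ, ℓ.Prime → ¬ ℓ ∣ p * A.conductorNorm ℤ * W.conductorNorm ℤ →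
      ‖embCoeff g ι ℓ - (W.frobeniusTrace ℓ : PadicAlgCl p)‖ < 1 := by
    intro ℓ hℓ hndvd
    haveI : Fact ℓ.Prime := ⟨hℓ⟩
    have hℓp : ℓ ≠ p := fun h ↦ hndvd (h ▸ dvd_mul_of_dvd_left (dvd_mul_right ℓ _) _)
    have hℓW : W.HasGoodReductionAtPrime ℓ :=
      hasGoodReductionAtPrime_of_not_dvd_conductorNorm W fun h ↦ hndvd (dvd_mul_of_dvd_right h _)
    have hℓA : A.HasGoodReductionAtPrime ℓ :=
      hasGoodReductionAtPrime_of_not_dvd_conductorNorm A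
        fun h ↦ hndvd (dvd_mul_of_dvd_left (dvd_mul_of_dvd_right h p) _)
    have hdvd : (p : ℤ) ∣ W.frobeniusTrace ℓ - A.frobeniusTrace ℓ :=
      KrausOesterle1992.dvd_frobeniusTrace_sub_of_addEquiv_geomTorsion W A p e hecomm ℓ hℓp hℓW hℓA
    have hcoef : cuspCoeff g ℓ = ((A.frobeniusTrace ℓ : ℤ) : ℂ) := by
      rw [hg.2 ℓ, A.LFunction_apply_prime_eq_frobeniusTrace ℓ hℓA]
    rw [embCoeff_eq_intCast g ι hcoef, ← Int.cast_sub]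
    exact norm_intCast_padicAlgCl_lt_one_of_dvd (dvd_sub_comm.mp hdvd)
  -- the level clause (p742955's `levelMatch`)
  have hlev : ∀ ℓ : ℕ, ℓ.Prime → ℓ ≠ p →
      max 2 (padicValNat ℓ (A.conductorNorm ℤ)) = max 2 (padicValNat ℓ (W.conductorNorm ℤ)) :=
    fun ℓ hℓ hℓp ↦
      Summit.BirchSwinnertonDyer.BirchSwinnertonDyer.Theorems.SmallImageLambdaLowerThreeNsThetaPartner.levelMatch
        hD hC hS W p ι hg.1 hcong hℓ hℓp
  -- `a_p(g) = a_p(A) = 0`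
  have hapg : cuspCoeff g p = 0 := by
    rw [hg.2 p, A.LFunction_apply_prime_eq_frobeniusTrace p hgoodA, hapA, Int.cast_zero]
  -- a Pollack pair for `g` (Pollack's theorem, proved in the tree)
  have hPol : ∃ Lp Lm : IwasawaAlgebra p, IsPollackPair g p Lp Lm :=
    exists_isPollackPair pollack_exists_plusMinusPAdicLFunction_holds hp hg hgoodA hapA
  exact ⟨hNA, g, ι, Ω, hg, hpN, hlev, hg.1, hapg, hΩ, hcong, hPol⟩

end Supply

/-! ## §3 The one-sided transport at a T1u pair -/

section TierUnit

variable (W A : WeierstrassCurve ℚ) [W.IsElliptic] [W.IsGloballyMinimal] [A.IsElliptic] [A.IsGloballyMinimal]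
  (p : ℕ) [Fact p.Prime]

/-- **The one-sided transport at a T1u pair, every sign, from print** (Kan₂ in the binder-free form §1 at the partner `f_A`; ENG = the
unit-curve engine `partnerLayerLambdaLower_of_unitCurvePartner`; supply §2). CONDITIONAL on the displayed named facts; per pair; NO
Pollack–Rubin, NO CM hypothesis on `W` or `A`. [cite: Vatsal1999, Thm. (1.6), (1.13)] [cite: BDKim2009, Cor. 2.13]
[cite: Kobayashi2003, (3.6), Thm. 1.2] -/
theorem lamTransport_le_of_unitCurvePartner
    (h12 : thm12_signedSelmerDual_finite_torsion)
    (h5 : realPeriodRat_eq_unit_mul_plusPeriod) (h3 : realPeriodRat_eq_unit_mul_plusPeriod_three)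
    (hD : Hida2000_thm326_exists_galoisRep) (hC : Carayol1986_artinConductorExponent)
    (hS : ∀ (V : WeierstrassCurve ℚ) (ℓ : ℕ) [Fact ℓ.Prime],
      V.swanConductorAt_rationalTate_eq_wildConductorExponent_of_ringChar_eq_two ℓ)
    (hmod : exists_isNewformOf)
    (hKim : BDKim2009.cor213_signedLambda_add_sum_delta_eq_of_torsionIso) (hV : vatsal1999_plusSymbol_congruence)
    (hp : p ≠ 2) (hX : ClassX7 W p) (hap : W.frobeniusTrace p = 0)
    (hgoodA : A.HasGoodReductionAtPrime p) (hapA : A.frobeniusTrace p = 0)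
    (he : ∃ e : geomTorsion W (p : ℤ) ≃+ geomTorsion A (p : ℤ),
      ∀ (σ : absoluteGaloisGroup ℚ) (P : geomTorsion W (p : ℤ)), e (σ • P) = σ • e P)
    {t : ℚ} (ht : A.entireLFunction 1 / (A.realPeriodRat : ℂ) = ((t : ℚ) : ℂ)) (ht0 : t ≠ 0)
    (hvt : padicValRat p t = 0) (ε : ℤˣ) :
    ∀ (κ : ZpExtension ℚ p) (γ : absoluteGaloisGroup ℚ),
      κ.IsCyclotomic → κ.IsTopGenerator γ → IsCyclotomicVariable p γ →
      ∀ [NeZero (W.conductorNorm ℤ)] (f : CuspForm (Gamma0 (W.conductorNorm ℤ)) 2),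
        IsNewformOf W f → ∀ (ϖ : ℚ), (ϖ : ℝ) * W.realPeriodRat = plusPeriod f →
      ∀ (Lplus Lminus : IwasawaAlgebra p), IsPollackPair f p Lplus Lminus →
        HasUnitContent (kobayashiL ε Lplus Lminus) →
      ∀ (D : SignedSelmerDualData W κ γ ε) [Module.Finite (IwasawaAlgebra p) D.X],
        Module.IsTorsion (IwasawaAlgebra p) D.X → D.mu = 0 →
      ∀ (G : IwasawaAlgebra p) (m : ℕ),
        iwasawaToPowerSeries p G =
          PowerSeries.C ((p : ℚ_[p]) ^ m * (ϖ : ℚ_[p])) * iwasawaToPowerSeries p (kobayashiL ε Lplus Lminus) →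
        lam G ≤ lambdaInvariant p D.X := by
  have hgood : W.HasGoodReductionAtPrime p := hX.1.1
  obtain ⟨iN, g, ι, Ω, hg, hpN, hlev, hnew, hapg, hΩ, hcong, hPol⟩ :=
    curvePartner_supply hD hC hS hmod W A p hp hgoodA hapA he
  intro κ γ hκ hγ hγ' _ f hf ϖ hϖ Lplus Lminus hPP hfl D _ hXt hμ G m hG
  exact lamTransport_le_of_partner W p hp hgood ε g ι Ω hpN
    (thetaLayerLambda_of_partner hV W p hp hX hap ε (A.conductorNorm ℤ) g ι Ω hpN hlev hnew hapg hΩ.isPlusPeriod hcong)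
    (fun κ γ hκ hγ _hγ' S₀ hS₀p hS₀W hS₀A D _ hXt hμ ↦
      partnerLayerLambdaLower_of_unitCurvePartner h12 hKim h5 h3 W A p hp hgood hap hgoodA hapA he g hg ι Ω
        hΩ.isPlusPeriod hPol ht ht0 hvt ε κ γ hκ hγ S₀ hS₀p hS₀W hS₀A D hXt hμ)
    κ γ hκ hγ hγ' f hf ϖ hϖ Lplus Lminus hPP hfl D hXt hμ G m hG

/-! ## §4 Crux L's body at a T1u pair -/

/-- ★ **TIER T1u AT `p = 3` IS CLOSED MODULO PRINT: crux L's body `∀ ε, KobayashiLowerDivisibility W 3 ε` at every small-image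
supersingular X7 pair with a UNIT CURVE PARTNER** (`A/ℚ` good at `3` with `a_3(A) = 0`, `W[3] ≃ A[3]` `Γ_ℚ`-equivariantly,
`L(A,1)/Ω_A` a non-zero `3`-adic unit) — from the displayed PUBLISHED named facts only (eleven; no Pollack–Rubin; the one-sign
`μ`-floor at `3` is THEOREM B, input-free). Per pair; CONDITIONAL on print; the class-wide crux L / BSD are NOT proved by this.
[cite: Kobayashi2003, Conjecture (p. 2), (3.6), Thm. 7.4 (p. 13)] [cite: BDKim2009, Cor. 2.13] [cite: Vatsal1999, Thm. (1.6), (1.13)]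
[cite: Fisher2012Hessian, §13] -/
theorem forall_kobayashiLowerDivisibility_three_of_unitCurvePartner (hp3 : p = 3)
    (hJ : thm62_63_73_signedColemanKato_zetaJoint) (h12 : thm12_signedSelmerDual_finite_torsion)
    (h41 : thm41_signedCharIdeal_divisibility)
    (h5 : realPeriodRat_eq_unit_mul_plusPeriod) (h3 : realPeriodRat_eq_unit_mul_plusPeriod_three)
    (hD : Hida2000_thm326_exists_galoisRep) (hC : Carayol1986_artinConductorExponent)
    (hS : ∀ (V : WeierstrassCurve ℚ) (ℓ : ℕ) [Fact ℓ.Prime],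
      V.swanConductorAt_rationalTate_eq_wildConductorExponent_of_ringChar_eq_two ℓ)
    (hmod : exists_isNewformOf)
    (hKim : BDKim2009.cor213_signedLambda_add_sum_delta_eq_of_torsionIso) (hV : vatsal1999_plusSymbol_congruence)
    (hX : ClassX7 W p) (hap : W.frobeniusTrace p = 0) (hs : ¬ Surj W p)
    (hgoodA : A.HasGoodReductionAtPrime p) (hapA : A.frobeniusTrace p = 0)
    (he : ∃ e : geomTorsion W (p : ℤ) ≃+ geomTorsion A (p : ℤ),
      ∀ (σ : absoluteGaloisGroup ℚ) (P : geomTorsion W (p : ℤ)), e (σ • P) = σ • e P)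
    {t : ℚ} (ht : A.entireLFunction 1 / (A.realPeriodRat : ℂ) = ((t : ℚ) : ℂ)) (ht0 : t ≠ 0)
    (hvt : padicValRat p t = 0) :
    ∀ ε : ℤˣ, KobayashiLowerDivisibility W p ε := by
  have hp : p ≠ 2 := by omega
  exact forall_kobayashiLowerDivisibility_three_of_lamTransport_le W p hp3 hJ h12 h41 h5 h3 hX hap hs
    (fun ε κ γ hκ hγ hγ' _ f hf ϖ hϖ Lplus Lminus hPP hfl D _ hXt hμ G m hG ↦
      lamTransport_le_of_unitCurvePartner W A p h12 h5 h3 hD hC hS hmod hKim hV hp hX hap hgoodA hapA he ht ht0 hvt ε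
        κ γ hκ hγ hγ' f hf ϖ hϖ Lplus Lminus hPP hfl D hXt hμ G m hG)

/-- ★ **TIER T1u AT ANY ODD `p` MODULO PRINT AND THE ONE-SIGN FLOOR AT THE PAIR**: crux L's body `∀ ε, KobayashiLowerDivisibility W p ε`
at a small-image supersingular X7 pair with a UNIT CURVE PARTNER, from the displayed PUBLISHED named facts (eleven; no Pollack–Rubin)
and ONE sign `ε₀` whose signed `p`-adic `L`-function of `W` has unit content (for `p = 3` not needed: previous theorem; for `p ≥ 5` =
`stub_muOneSign_ns_ge5` AT THIS PAIR). Per pair; CONDITIONAL; closes nothing class-wide.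
[cite: Kobayashi2003, Conjecture (p. 2), (3.6), Thm. 7.4 (p. 13)] [cite: Pollack2003, Conj. 6.3, Prop. 6.18] [cite: BDKim2009, Cor. 2.13]
[cite: Vatsal1999, Thm. (1.6), (1.13)] -/
theorem forall_kobayashiLowerDivisibility_of_unitCurvePartner_of_oneSignFloor
    (hJ : thm62_63_73_signedColemanKato_zetaJoint) (h12 : thm12_signedSelmerDual_finite_torsion)
    (h41 : thm41_signedCharIdeal_divisibility)
    (h5 : realPeriodRat_eq_unit_mul_plusPeriod) (h3 : realPeriodRat_eq_unit_mul_plusPeriod_three)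
    (hD : Hida2000_thm326_exists_galoisRep) (hC : Carayol1986_artinConductorExponent)
    (hS : ∀ (V : WeierstrassCurve ℚ) (ℓ : ℕ) [Fact ℓ.Prime],
      V.swanConductorAt_rationalTate_eq_wildConductorExponent_of_ringChar_eq_two ℓ)
    (hmod : exists_isNewformOf)
    (hKim : BDKim2009.cor213_signedLambda_add_sum_delta_eq_of_torsionIso) (hV : vatsal1999_plusSymbol_congruence)
    (hp : p ≠ 2) (hX : ClassX7 W p) (hap : W.frobeniusTrace p = 0) (hs : ¬ Surj W p)
    (hgoodA : A.HasGoodReductionAtPrime p) (hapA : A.frobeniusTrace p = 0)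
    (he : ∃ e : geomTorsion W (p : ℤ) ≃+ geomTorsion A (p : ℤ),
      ∀ (σ : absoluteGaloisGroup ℚ) (P : geomTorsion W (p : ℤ)), e (σ • P) = σ • e P)
    {t : ℚ} (ht : A.entireLFunction 1 / (A.realPeriodRat : ℂ) = ((t : ℚ) : ℂ)) (ht0 : t ≠ 0)
    (hvt : padicValRat p t = 0)
    (hfloor : ∀ [NeZero (W.conductorNorm ℤ)] (f : CuspForm (Gamma0 (W.conductorNorm ℤ)) 2), IsNewformOf W f →
      ∃ (ε₀ : ℤˣ) (L₀ : IwasawaAlgebra p), IsSignedPAdicLFunction f p ε₀ L₀ ∧ HasUnitContent L₀) :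
    ∀ ε : ℤˣ, KobayashiLowerDivisibility W p ε := by
  obtain ⟨ε₀, hε₀⟩ := LargeImageMuFloor.exists_sign_forall_isNewformOf (W := W)
    (fun ε f ↦ ∃ L₀ : IwasawaAlgebra p, IsSignedPAdicLFunction f p ε L₀ ∧ HasUnitContent L₀)
    (fun f hf ↦ hfloor f hf)
  have hfl : ∀ [NeZero (W.conductorNorm ℤ)] (f : CuspForm (Gamma0 (W.conductorNorm ℤ)) 2), IsNewformOf W f →
      ∀ Lplus Lminus : IwasawaAlgebra p, IsPollackPair f p Lplus Lminus →
        HasUnitContent (kobayashiL ε₀ Lplus Lminus) := by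
    intro _ f hf Lplus Lminus hPP
    obtain ⟨L₀, hL₀, hu⟩ := hε₀ f hf
    rwa [IsSignedPAdicLFunction.unique hL₀ (hPP.isSignedPAdicLFunction_kobayashiL ε₀)] at hu
  have hMC : KobayashiMainConjecture W p ε₀ :=
    kobayashiMainConjecture_of_lamTransport_le W p hp (thm62_63_73_signedColemanKato_zeta_of_joint hJ) h12 h41 h5 h3
      hX.1.1 hap hs ε₀ (fun f hf Lplus Lminus hPP ↦ hfl f hf Lplus Lminus hPP)
      (fun κ γ hκ hγ hγ' _ f hf ϖ hϖ Lplus Lminus hPP D _ hXt hμ G m hG ↦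
        lamTransport_le_of_unitCurvePartner W A p h12 h5 h3 hD hC hS hmod hKim hV hp hX hap hgoodA hapA he ht ht0 hvt ε₀
          κ γ hκ hγ hγ' f hf ϖ hϖ Lplus Lminus hPP (hfl f hf Lplus Lminus hPP) D hXt hμ G m hG)
  exact fun ε ↦ (SignDefect.X7.exists_kobayashiLowerDivisibility_iff_forall W p h12 h5 h3 hJ hp hX hap).mp
    ⟨ε₀, kobayashiLowerDivisibility_of_mainConjecture hMC⟩ ε

end TierUnit

end Summit.BirchSwinnertonDyer.BirchSwinnertonDyer.Theorems.SmallImageRttOneSided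

end
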